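import Summits.QuantumFields.BalabanUV.Beta.GAN24.SaddlePointBoundInverse

/-!
# `BalabanUV.Beta.GAN24.KernelCoercivitySplit` — binder row G-an2-4 / (CONV-C), road P1-fibre, typer row **P1-Y10k** (DAG node N15κ) of
# `HOME/GAN24/Formal/LEAVES.md` v2.5: KERNEL COERCIVITY AND THE LBB CONSTANT FROM A GOOD/BAD INDEX SPLIT, in EXACTLY the currency of
# `SaddlePointBound` (leaf P1-L10a): `𝕜` an `RCLike` field, `EuclideanSpace 𝕜 n`, `Matrix.toEuclideanLin`.

NOT IN PRINT; OUR PROOF (of textbook finite-dimensional linear algebra).  HONEST FRAMING (cell contract, verbatim): «discharging `BetaPertH`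
makes Bałaban's UV stability UNCONDITIONAL — a real constructive-QFT result; it is NOT the continuum limit and NOT the Clay problem.»
HONEST DEPENDENCY (verbatim): «continuum YM on T⁴ ⇐ BetaPertH ∧ nine spine estimates (0/9 proved); BetaPertH ⇐ (D1) ∧ (D4) ∧ CAP+tail;
G-an2-4 gates asym, D1 and NE2/3/4.»  [folklore] throughout; no cited fact, no `def`, no wall binder; an INPUT of node N15k (the `N`- and
`p`-uniform Brezzi numbers of the fine KKT symbol), itself an input of leaf P1-L10 = (I3′); NOTHING of (CONV-C)'s K-slot `ConvCK 3 Lc` is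
discharged here.  NOT `BetaPertH`, NOT continuum, NOT Clay.  NOT summit progress.

## What is proved (index type `n` of the primal unknowns, `m` of the constraint rows; a finset `Z : Finset n` of «bad» coordinates,
## «good» = `Zᶜ`; all constants explicit; `B : Matrix m n 𝕜` the constraint rows, `H : Matrix n n 𝕜` the primal block)
* §1 bookkeeping: `‖x‖² = Σ_{i∈Z} ‖x i‖² + Σ_{i∈Zᶜ} ‖x i‖²`; the coordinate cut-off `x|_Z := toLp 2 (fun i => if i ∈ Z then x i else 0)`
  has `‖x|_Z‖² = Σ_{i∈Z} ‖x i‖²` and `x = x|_Z + x|_{Zᶜ}`.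
* §2 **(a) coercivity transfer** `coercive_of_dominated` (abstract: any «good energy» `G` with `‖x‖² ≤ K·G x` on `ker B`) and
  `coercive_of_split`: if on `ker B` the form dominates the GOOD mass, `lam·Σ_{i∈Zᶜ}‖x i‖² ≤ re ⟪x, H x⟫`
  (`0 ≤ lam`; e.g. from a diagonal lower bound with weights `≥ lam` off `Z` and `≥ 0` on `Z`, `good_mass_le_weighted`), and on `ker B` the
  bad mass is controlled by the good mass, `Σ_{i∈Z}‖x i‖² ≤ C·Σ_{i∈Zᶜ}‖x i‖²` (`0 ≤ C`), then
  `∀ x, B x = 0 → (lam/(1+C))·‖x‖² ≤ re ⟪x, H x⟫` — LITERALLY the binder `hcoer` of `SaddlePointBound.matrix_test_vector_of_coercive` /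
  `matrix_apriori_conjTranspose` / `isUnit_fromBlocks_conjTranspose` and of `SaddlePointBoundInverse.inv_entry_bound_conjTranspose`.
* §3 **(b) kernel control from the columns** `norm_cut_le_of_ker`, `bad_mass_le_of_ker`: if `B` is bounded BELOW by `βZ > 0` on vectors
  supported in `Z` (bad columns injective with constant) and bounded ABOVE by `bG` on vectors supported in `Zᶜ` (good columns bounded), then
  on `ker B`: `‖x|_Z‖ ≤ (bG/βZ)·‖x|_{Zᶜ}‖`, i.e. `C = (bG/βZ)²` in (a); `norm_sq_le_frobenius_of_support`, `norm_le_of_support_compl`: the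
  good-column bound `bG` from the Frobenius mass `Σ_k Σ_{i∈Zᶜ} ‖B k i‖² ≤ bG²` (row-wise Cauchy–Schwarz on the support).
* §4 **(c) LBB from the bad columns alone** `lbb_of_bad_columns`: `‖Bᴴ q‖² ≥ Σ_{i∈Z} ‖(Bᴴ q) i‖²`, so `β²‖q‖² ≤ Σ_{i∈Z}‖(Bᴴ q) i‖²` for all
  `q` gives the binder `hB : β‖q‖ ≤ ‖Bᴴ q‖`; `lbb_of_subblock`: the same from a sub-block `BZ` of columns `e j` (`e` injective) with
  `β‖q‖ ≤ ‖BZᴴ q‖`; `adjoint_bounded_below_of_square`: for a SQUARE block, `β‖a‖ ≤ ‖BZ a‖` (`β > 0`) already gives `β‖q‖ ≤ ‖BZᴴ q‖`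
  (`σ_min(BZ) = σ_min(BZᴴ)`), so one lower bound serves both (b) and (c).
* §5 **(d) Schur test** `norm_toEuclideanLin_le_schur`: row sums `≤ R` and column sums `≤ C` of `‖H i j‖` give `‖H v‖ ≤ √(R·C)·‖v‖`
  (the binder `hH : ‖H v‖ ≤ η‖v‖`); `…_of_row_col_le`: `R = C = ρ ⟹ ‖H v‖ ≤ ρ‖v‖`.
* §6 **assembly BY NAME**: `coercive_of_columns` ((a)+(b): `γ = lam/(1 + (bG/βZ)²)`), `isUnit_fromBlocks_of_split`,
  `inv_entry_bound_of_split` — the split data fed into `SaddlePointBound.isUnit_fromBlocks_conjTranspose` and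
  `SaddlePointBoundInverse.inv_entry_bound_conjTranspose` verbatim.

## Fibre reading (for the N15k owner; nothing of it is used or asserted in this file)
indices `n` = aliases `m` × polarisations, `Z` = the zero alias `m = 0` (where the symbol `λ(k₀) = |p|²/N² → 0`), good = `m ≠ 0` with
`λ ≥ c/N²` in scaled units (N03 `SymbolTaylor`, N08 `FibreGaffney`); `B` = the block-averaging constraint rows with weights `w_m`: the bad
columns are `w₀·𝟙` with `|w₀(p)| ≥ (2/π)^D` on the Brillouin zone (a vector supported in `Z` is mapped to `w₀·` itself, so `hBZ` holds with
`βZ = |w₀(p)| ≥ (2/π)^D`, and `lbb_of_bad_columns` / `adjoint_bounded_below_of_square` give the same number as the LBB constant `β`), the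
good columns have Frobenius mass `Σ_{m≠0}‖w_m‖² ≤ bG²` (`FibreBlockBounds`, `ReadingWeightSums`; `norm_le_of_support_compl`); ⇒
`γ = c/((1 + (bG/βZ)²)N²)`, `β = (2/π)^D`, uniform in `p` (including `p = 0`) and `N`.
-/

open scoped InnerProductSpace
open RCLike Matrix WithLp

namespace Summit.QuantumFields.BalabanUV.Beta.GAN24.KernelCoercivitySplit

open SaddlePointBound SaddlePointBoundInverse

variable {𝕜 : Type*} [RCLike 𝕜]
variable {n m : Type*} [Fintype n] [DecidableEq n] [Fintype m] [DecidableEq m]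

/-! ## §1 Splitting the Euclidean norm along a finset `Z` of «bad» coordinates -/

/-- [folklore] `‖x‖² = Σ_{i ∈ Z} ‖x i‖² + Σ_{i ∈ Zᶜ} ‖x i‖²`. -/
theorem norm_sq_eq_bad_add_good (Z : Finset n) (x : EuclideanSpace 𝕜 n) :
    ‖x‖ ^ 2 = ∑ i ∈ Z, ‖x i‖ ^ 2 + ∑ i ∈ Zᶜ, ‖x i‖ ^ 2 := by
  rw [EuclideanSpace.norm_sq_eq, Finset.sum_add_sum_compl]

/-- [folklore] The coordinate cut-off `x|_Z` (zero off `Z`) has squared norm `Σ_{i ∈ Z} ‖x i‖²`. -/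
theorem norm_sq_cut (Z : Finset n) (x : EuclideanSpace 𝕜 n) :
    ‖(toLp 2 (fun i => if i ∈ Z then x i else 0) : EuclideanSpace 𝕜 n)‖ ^ 2 = ∑ i ∈ Z, ‖x i‖ ^ 2 := by
  rw [EuclideanSpace.norm_sq_eq]
  have h : ∀ i, ‖(toLp 2 (fun i => if i ∈ Z then x i else 0) : EuclideanSpace 𝕜 n) i‖ ^ 2 =
      if i ∈ Z then ‖x i‖ ^ 2 else 0 := by
    intro i
    rw [PiLp.toLp_apply]
    split_ifs <;> simp
  simp_rw [h, Finset.sum_ite_mem, Finset.univ_inter]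

/-- [folklore] `x = x|_Z + x|_{Zᶜ}`. -/
theorem cut_add_cut_compl (Z : Finset n) (x : EuclideanSpace 𝕜 n) :
    (toLp 2 (fun i => if i ∈ Z then x i else 0) : EuclideanSpace 𝕜 n) +
      toLp 2 (fun i => if i ∈ Zᶜ then x i else 0) = x := by
  ext i
  rw [← WithLp.toLp_add, PiLp.toLp_apply, Pi.add_apply]
  simp only [Finset.mem_compl]
  split_ifs <;> simp

/-! ## §2 (a) Coercivity on `ker B` from coercivity on the good coordinates -/

omit [Fintype m] [DecidableEq m] in
/-- [folklore] **Coercivity transfer, abstract form.**  If on `ker B` the real part of the form dominates `lam·G x` for some «good energy»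
`G` (any real function: a partial mass, a weighted mass, a transverse energy …) and `‖x‖² ≤ K·G x` on `ker B` (`0 ≤ lam`, `0 < K`), then
`re ⟪x, H x⟫ ≥ (lam/K)‖x‖²` on `ker B`. -/
theorem coercive_of_dominated {H : Matrix n n 𝕜} {B : Matrix m n 𝕜} (G : EuclideanSpace 𝕜 n → ℝ) {lam K : ℝ}
    (hlam : 0 ≤ lam) (hK : 0 < K)
    (hH : ∀ x : EuclideanSpace 𝕜 n, toEuclideanLin B x = 0 → lam * G x ≤ re ⟪x, toEuclideanLin H x⟫_𝕜)
    (hG : ∀ x : EuclideanSpace 𝕜 n, toEuclideanLin B x = 0 → ‖x‖ ^ 2 ≤ K * G x) :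
    ∀ x : EuclideanSpace 𝕜 n, toEuclideanLin B x = 0 → lam / K * ‖x‖ ^ 2 ≤ re ⟪x, toEuclideanLin H x⟫_𝕜 := by
  intro x hx
  calc lam / K * ‖x‖ ^ 2 ≤ lam / K * (K * G x) := mul_le_mul_of_nonneg_left (hG x hx) (div_nonneg hlam hK.le)
    _ = lam * G x := by rw [← mul_assoc, div_mul_cancel₀ lam hK.ne']
    _ ≤ re ⟪x, toEuclideanLin H x⟫_𝕜 := hH x hx

omit [Fintype m] [DecidableEq m] in
/-- [folklore] **Coercivity transfer from a good/bad split.**  If on `ker B` the real part of the form dominates `lam` times the good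
mass and the bad mass is at most `C` times the good mass, then `re ⟪x, H x⟫ ≥ (lam/(1+C))‖x‖²` on `ker B` — the binder `hcoer` of
`SaddlePointBound.matrix_test_vector_of_coercive` / `matrix_apriori_conjTranspose` / `isUnit_fromBlocks_conjTranspose`. -/
theorem coercive_of_split (Z : Finset n) {H : Matrix n n 𝕜} {B : Matrix m n 𝕜} {lam C : ℝ}
    (hlam : 0 ≤ lam) (hC : 0 ≤ C)
    (hH : ∀ x : EuclideanSpace 𝕜 n, toEuclideanLin B x = 0 →
      lam * ∑ i ∈ Zᶜ, ‖x i‖ ^ 2 ≤ re ⟪x, toEuclideanLin H x⟫_𝕜)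
    (hker : ∀ x : EuclideanSpace 𝕜 n, toEuclideanLin B x = 0 →
      ∑ i ∈ Z, ‖x i‖ ^ 2 ≤ C * ∑ i ∈ Zᶜ, ‖x i‖ ^ 2) :
    ∀ x : EuclideanSpace 𝕜 n, toEuclideanLin B x = 0 →
      lam / (1 + C) * ‖x‖ ^ 2 ≤ re ⟪x, toEuclideanLin H x⟫_𝕜 := by
  refine coercive_of_dominated (fun x => ∑ i ∈ Zᶜ, ‖x i‖ ^ 2) hlam (by linarith) hH fun x hx => ?_
  rw [norm_sq_eq_bad_add_good Z x]
  have := hker x hx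
  linarith

/-- [folklore] A diagonal lower bound `Σ_i w_i ‖x i‖²` with weights `w_i ≥ lam` off `Z` and `w_i ≥ 0` on `Z` dominates `lam` times the
good mass `Σ_{i ∈ Zᶜ} ‖x i‖²` (the hypothesis shape of `coercive_of_split`). -/
theorem good_mass_le_weighted (Z : Finset n) {w : n → ℝ} {lam : ℝ}
    (hw : ∀ i, i ∉ Z → lam ≤ w i) (hw0 : ∀ i ∈ Z, 0 ≤ w i) (x : EuclideanSpace 𝕜 n) :
    lam * ∑ i ∈ Zᶜ, ‖x i‖ ^ 2 ≤ ∑ i, w i * ‖x i‖ ^ 2 := by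
  rw [← Finset.sum_add_sum_compl Z, Finset.mul_sum]
  have h1 : 0 ≤ ∑ i ∈ Z, w i * ‖x i‖ ^ 2 :=
    Finset.sum_nonneg fun i hi => mul_nonneg (hw0 i hi) (sq_nonneg _)
  have h2 : ∑ i ∈ Zᶜ, lam * ‖x i‖ ^ 2 ≤ ∑ i ∈ Zᶜ, w i * ‖x i‖ ^ 2 :=
    Finset.sum_le_sum fun i hi =>
      mul_le_mul_of_nonneg_right (hw i (Finset.mem_compl.mp hi)) (sq_nonneg _)
  linarith

/-! ## §3 (b) Kernel control of the bad coordinates from the columns -/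

omit [DecidableEq m] in
/-- [folklore] **Kernel tilt from the columns.**  If `B` is bounded below by `βZ > 0` on vectors supported in `Z` and bounded by `bG`
on vectors supported in `Zᶜ`, then every `x ∈ ker B` has `‖x|_Z‖ ≤ (bG/βZ)·‖x|_{Zᶜ}‖` (from `B x|_Z = −B x|_{Zᶜ}`). -/
theorem norm_cut_le_of_ker (Z : Finset n) {B : Matrix m n 𝕜} {βZ bG : ℝ} (hβ : 0 < βZ)
    (hBZ : ∀ y : EuclideanSpace 𝕜 n, (∀ i, i ∉ Z → y i = 0) → βZ * ‖y‖ ≤ ‖toEuclideanLin B y‖)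
    (hBG : ∀ y : EuclideanSpace 𝕜 n, (∀ i ∈ Z, y i = 0) → ‖toEuclideanLin B y‖ ≤ bG * ‖y‖)
    {x : EuclideanSpace 𝕜 n} (hx : toEuclideanLin B x = 0) :
    ‖(toLp 2 (fun i => if i ∈ Z then x i else 0) : EuclideanSpace 𝕜 n)‖ ≤
      bG / βZ * ‖(toLp 2 (fun i => if i ∈ Zᶜ then x i else 0) : EuclideanSpace 𝕜 n)‖ := by
  set xZ : EuclideanSpace 𝕜 n := toLp 2 (fun i => if i ∈ Z then x i else 0) with hxZ
  set xG : EuclideanSpace 𝕜 n := toLp 2 (fun i => if i ∈ Zᶜ then x i else 0) with hxG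
  have hsum : xZ + xG = x := cut_add_cut_compl Z x
  have hBsum : toEuclideanLin B xZ = -toEuclideanLin B xG := by
    rw [eq_neg_iff_add_eq_zero, ← map_add, hsum, hx]
  have h1 : βZ * ‖xZ‖ ≤ ‖toEuclideanLin B xZ‖ :=
    hBZ xZ fun i hi => by simp [hxZ, PiLp.toLp_apply, hi]
  have h2 : ‖toEuclideanLin B xG‖ ≤ bG * ‖xG‖ :=
    hBG xG fun i hi => by simp [hxG, PiLp.toLp_apply, Finset.mem_compl, hi]
  rw [hBsum, norm_neg] at h1
  rw [div_mul_eq_mul_div, le_div_iff₀ hβ]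
  calc ‖xZ‖ * βZ = βZ * ‖xZ‖ := mul_comm _ _
    _ ≤ ‖toEuclideanLin B xG‖ := h1
    _ ≤ bG * ‖xG‖ := h2

omit [DecidableEq m] in
/-- [folklore] **Kernel control, mass form** (the hypothesis `hker` of `coercive_of_split` with `C = (bG/βZ)²`): on `ker B`,
`Σ_{i ∈ Z} ‖x i‖² ≤ (bG/βZ)²·Σ_{i ∈ Zᶜ} ‖x i‖²`. -/
theorem bad_mass_le_of_ker (Z : Finset n) {B : Matrix m n 𝕜} {βZ bG : ℝ} (hβ : 0 < βZ)
    (hBZ : ∀ y : EuclideanSpace 𝕜 n, (∀ i, i ∉ Z → y i = 0) → βZ * ‖y‖ ≤ ‖toEuclideanLin B y‖)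
    (hBG : ∀ y : EuclideanSpace 𝕜 n, (∀ i ∈ Z, y i = 0) → ‖toEuclideanLin B y‖ ≤ bG * ‖y‖)
    {x : EuclideanSpace 𝕜 n} (hx : toEuclideanLin B x = 0) :
    ∑ i ∈ Z, ‖x i‖ ^ 2 ≤ (bG / βZ) ^ 2 * ∑ i ∈ Zᶜ, ‖x i‖ ^ 2 := by
  rw [← norm_sq_cut Z x, ← norm_sq_cut Zᶜ x, ← mul_pow]
  exact pow_le_pow_left₀ (norm_nonneg _) (norm_cut_le_of_ker Z hβ hBZ hBG hx) 2

omit [DecidableEq m] in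
/-- [folklore] **Good columns bounded: Frobenius on the support.**  If `y` vanishes on `Z` then
`‖B y‖² ≤ (Σ_k Σ_{i ∈ Zᶜ} ‖B k i‖²)·‖y‖²` (row-wise Cauchy–Schwarz over the good columns only). -/
theorem norm_sq_le_frobenius_of_support (Z : Finset n) (B : Matrix m n 𝕜) {y : EuclideanSpace 𝕜 n}
    (hy : ∀ i ∈ Z, y i = 0) :
    ‖toEuclideanLin B y‖ ^ 2 ≤ (∑ k, ∑ i ∈ Zᶜ, ‖B k i‖ ^ 2) * ‖y‖ ^ 2 := by
  have hcoord : ∀ k, ‖toEuclideanLin B y k‖ ^ 2 ≤ (∑ i ∈ Zᶜ, ‖B k i‖ ^ 2) * ∑ i ∈ Zᶜ, ‖y i‖ ^ 2 := by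
    intro k
    have hz : ∑ i ∈ Z, B k i * y i = 0 := Finset.sum_eq_zero fun i hi => by rw [hy i hi, mul_zero]
    have e1 : toEuclideanLin B y k = ∑ i ∈ Zᶜ, B k i * y i := by
      simp only [Matrix.ofLp_toLpLin, Matrix.toLin'_apply, Matrix.mulVec, dotProduct]
      rw [← Finset.sum_add_sum_compl Z, hz, zero_add]
    rw [e1]
    calc ‖∑ i ∈ Zᶜ, B k i * y i‖ ^ 2 ≤ (∑ i ∈ Zᶜ, ‖B k i‖ * ‖y i‖) ^ 2 :=
          pow_le_pow_left₀ (norm_nonneg _)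
            ((norm_sum_le _ _).trans (le_of_eq (Finset.sum_congr rfl fun i _ => norm_mul _ _))) 2
      _ ≤ (∑ i ∈ Zᶜ, ‖B k i‖ ^ 2) * ∑ i ∈ Zᶜ, ‖y i‖ ^ 2 := Finset.sum_mul_sq_le_sq_mul_sq _ _ _
  have hz' : ∑ i ∈ Z, ‖y i‖ ^ 2 = 0 :=
    Finset.sum_eq_zero fun i hi => by rw [hy i hi, norm_zero, zero_pow two_ne_zero]
  have hgood : ∑ i ∈ Zᶜ, ‖y i‖ ^ 2 = ‖y‖ ^ 2 := by
    rw [norm_sq_eq_bad_add_good Z y, hz', zero_add]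
  rw [EuclideanSpace.norm_sq_eq (toEuclideanLin B y), Finset.sum_mul]
  exact Finset.sum_le_sum fun k _ => (hcoord k).trans (by rw [hgood])

omit [DecidableEq m] in
/-- [folklore] **Good columns bounded** (the hypothesis `hBG` of `norm_cut_le_of_ker`): a Frobenius budget `Σ_k Σ_{i ∈ Zᶜ} ‖B k i‖² ≤ bG²`
of the good columns gives `‖B y‖ ≤ bG‖y‖` for every `y` supported in `Zᶜ`. -/
theorem norm_le_of_support_compl (Z : Finset n) (B : Matrix m n 𝕜) {bG : ℝ} (hbG : 0 ≤ bG)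
    (hfrob : ∑ k, ∑ i ∈ Zᶜ, ‖B k i‖ ^ 2 ≤ bG ^ 2) :
    ∀ y : EuclideanSpace 𝕜 n, (∀ i ∈ Z, y i = 0) → ‖toEuclideanLin B y‖ ≤ bG * ‖y‖ := by
  intro y hy
  have h := (norm_sq_le_frobenius_of_support Z B hy).trans (mul_le_mul_of_nonneg_right hfrob (sq_nonneg _))
  rw [← mul_pow] at h
  exact (pow_le_pow_iff_left₀ (norm_nonneg _) (mul_nonneg hbG (norm_nonneg _)) two_ne_zero).mp h

/-! ## §4 (c) The LBB constant from the bad columns alone -/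

omit [DecidableEq n] in
/-- [folklore] **LBB from the bad columns.**  `‖Bᴴ q‖² = Σ_i ‖(Bᴴ q) i‖² ≥ Σ_{i ∈ Z} ‖(Bᴴ q) i‖²`; so a lower bound
`β²‖q‖² ≤ Σ_{i ∈ Z} ‖(Bᴴ q) i‖²` computed on the bad columns only gives the binder `hB : β‖q‖ ≤ ‖Bᴴ q‖` of `SaddlePointBound`. -/
theorem lbb_of_bad_columns (Z : Finset n) {B : Matrix m n 𝕜} {β : ℝ} (hβ : 0 ≤ β)
    (hZ : ∀ q : EuclideanSpace 𝕜 m, β ^ 2 * ‖q‖ ^ 2 ≤ ∑ i ∈ Z, ‖toEuclideanLin Bᴴ q i‖ ^ 2) :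
    ∀ q : EuclideanSpace 𝕜 m, β * ‖q‖ ≤ ‖toEuclideanLin Bᴴ q‖ := by
  intro q
  have h1 : ∑ i ∈ Z, ‖toEuclideanLin Bᴴ q i‖ ^ 2 ≤ ‖toEuclideanLin Bᴴ q‖ ^ 2 := by
    rw [EuclideanSpace.norm_sq_eq]
    exact Finset.sum_le_univ_sum_of_nonneg fun i => sq_nonneg _
  have h2 : (β * ‖q‖) ^ 2 ≤ ‖toEuclideanLin Bᴴ q‖ ^ 2 := by
    rw [mul_pow]; exact (hZ q).trans h1
  exact (pow_le_pow_iff_left₀ (mul_nonneg hβ (norm_nonneg _)) (norm_nonneg _) two_ne_zero).mp h2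

omit [Fintype n] [DecidableEq n] in
/-- [folklore] Coordinates of `Aᴴ q`: `(Aᴴ q) i = Σ_k conj (A k i) · q k`. -/
theorem toEuclideanLin_conjTranspose_apply (A : Matrix m n 𝕜) (q : EuclideanSpace 𝕜 m) (i : n) :
    toEuclideanLin Aᴴ q i = ∑ k, star (A k i) * q k := by
  simp only [Matrix.ofLp_toLpLin, Matrix.toLin'_apply, Matrix.mulVec, dotProduct, Matrix.conjTranspose_apply]

/-- [folklore] **LBB from a sub-block of columns.**  If the columns `e j` of `B` (`e : z → n` injective) form the matrix `BZ` and
`β‖q‖ ≤ ‖BZᴴ q‖` for all `q` (`0 ≤ β`), then `β‖q‖ ≤ ‖Bᴴ q‖` for all `q`. -/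
theorem lbb_of_subblock {z : Type*} [Fintype z] [DecidableEq z] {e : z → n} (he : Function.Injective e)
    {B : Matrix m n 𝕜} {BZ : Matrix m z 𝕜} (hcol : ∀ k j, B k (e j) = BZ k j) {β : ℝ} (hβ : 0 ≤ β)
    (hBZ : ∀ q : EuclideanSpace 𝕜 m, β * ‖q‖ ≤ ‖toEuclideanLin BZᴴ q‖) :
    ∀ q : EuclideanSpace 𝕜 m, β * ‖q‖ ≤ ‖toEuclideanLin Bᴴ q‖ := by
  refine lbb_of_bad_columns (Finset.univ.image e) hβ fun q => ?_
  have h2 : ‖toEuclideanLin BZᴴ q‖ ^ 2 = ∑ i ∈ Finset.univ.image e, ‖toEuclideanLin Bᴴ q i‖ ^ 2 := by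
    rw [EuclideanSpace.norm_sq_eq, Finset.sum_image fun j _ j' _ h => he h]
    refine Finset.sum_congr rfl fun j _ => ?_
    rw [toEuclideanLin_conjTranspose_apply, toEuclideanLin_conjTranspose_apply]
    simp_rw [hcol]
  calc β ^ 2 * ‖q‖ ^ 2 = (β * ‖q‖) ^ 2 := by ring
    _ ≤ ‖toEuclideanLin BZᴴ q‖ ^ 2 := pow_le_pow_left₀ (mul_nonneg hβ (norm_nonneg _)) (hBZ q) 2
    _ = _ := h2

/-- [folklore] **Square bad block: one lower bound serves (b) and (c).**  If `BZ : Matrix m m 𝕜` is bounded below by `β > 0`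
(`β‖a‖ ≤ ‖BZ a‖`), then so is its conjugate transpose: `β‖q‖ ≤ ‖BZᴴ q‖` (`BZ` is then invertible and `σ_min(BZ) = σ_min(BZᴴ)`;
proof: `‖q‖² = re ⟪BZ a, q⟫ = re ⟪a, BZᴴ q⟫ ≤ ‖a‖‖BZᴴ q‖ ≤ β⁻¹‖q‖‖BZᴴ q‖` with `BZ a = q`). -/
theorem adjoint_bounded_below_of_square {BZ : Matrix m m 𝕜} {β : ℝ} (hβ : 0 < β)
    (hBZ : ∀ a : EuclideanSpace 𝕜 m, β * ‖a‖ ≤ ‖toEuclideanLin BZ a‖) :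
    ∀ q : EuclideanSpace 𝕜 m, β * ‖q‖ ≤ ‖toEuclideanLin BZᴴ q‖ := by
  have hinj : Function.Injective (toEuclideanLin BZ) := by
    intro a b hab
    have h := hBZ (a - b)
    rw [map_sub, hab, sub_self, norm_zero] at h
    have h0 : ‖a - b‖ ≤ 0 := by
      by_contra hc
      exact absurd h (not_le.mpr (mul_pos hβ (not_le.mp hc)))
    exact sub_eq_zero.mp (norm_le_zero_iff.mp h0)
  have hsurj : Function.Surjective (toEuclideanLin BZ) := LinearMap.injective_iff_surjective.mp hinj
  intro q
  obtain ⟨a, ha⟩ := hsurj q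
  have h1 : ‖q‖ ^ 2 = re ⟪a, toEuclideanLin BZᴴ q⟫_𝕜 := by
    rw [Matrix.toEuclideanLin_conjTranspose_eq_adjoint, LinearMap.adjoint_inner_right, ha, inner_self_eq_norm_sq]
  have h2 : re ⟪a, toEuclideanLin BZᴴ q⟫_𝕜 ≤ ‖a‖ * ‖toEuclideanLin BZᴴ q‖ := re_inner_le_norm _ _
  have h3 : β * ‖a‖ ≤ ‖q‖ := by rw [← ha]; exact hBZ a
  by_cases hq : q = 0
  · rw [hq, norm_zero, mul_zero]; exact norm_nonneg _
  · have hqpos : 0 < ‖q‖ := norm_pos_iff.mpr hq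
    have h4 : (β * ‖q‖) * ‖q‖ ≤ ‖toEuclideanLin BZᴴ q‖ * ‖q‖ := by
      calc (β * ‖q‖) * ‖q‖ = β * ‖q‖ ^ 2 := by ring
        _ = β * re ⟪a, toEuclideanLin BZᴴ q⟫_𝕜 := by rw [h1]
        _ ≤ β * (‖a‖ * ‖toEuclideanLin BZᴴ q‖) := mul_le_mul_of_nonneg_left h2 hβ.le
        _ = (β * ‖a‖) * ‖toEuclideanLin BZᴴ q‖ := by ring
        _ ≤ ‖q‖ * ‖toEuclideanLin BZᴴ q‖ := mul_le_mul_of_nonneg_right h3 (norm_nonneg _)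
        _ = ‖toEuclideanLin BZᴴ q‖ * ‖q‖ := mul_comm _ _
    exact le_of_mul_le_mul_right h4 hqpos

/-! ## §5 (d) Operator-norm bookkeeping: the Schur test -/

/-- [folklore] Weighted Cauchy–Schwarz: `(Σ_j a_j b_j)² ≤ (Σ_j a_j)·(Σ_j a_j b_j²)` for weights `a_j ≥ 0`. -/
theorem sq_sum_mul_le {ι : Type*} (s : Finset ι) {a b : ι → ℝ} (ha : ∀ j ∈ s, 0 ≤ a j) :
    (∑ j ∈ s, a j * b j) ^ 2 ≤ (∑ j ∈ s, a j) * ∑ j ∈ s, a j * b j ^ 2 := by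
  have key := Finset.sum_mul_sq_le_sq_mul_sq s (fun j => Real.sqrt (a j)) (fun j => Real.sqrt (a j) * b j)
  have e1 : ∀ j ∈ s, Real.sqrt (a j) * (Real.sqrt (a j) * b j) = a j * b j := fun j hj => by
    rw [← mul_assoc, Real.mul_self_sqrt (ha j hj)]
  have e2 : ∀ j ∈ s, Real.sqrt (a j) ^ 2 = a j := fun j hj => Real.sq_sqrt (ha j hj)
  have e3 : ∀ j ∈ s, (Real.sqrt (a j) * b j) ^ 2 = a j * b j ^ 2 := fun j hj => by
    rw [mul_pow, Real.sq_sqrt (ha j hj)]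
  rwa [Finset.sum_congr rfl e1, Finset.sum_congr rfl e2, Finset.sum_congr rfl e3] at key

/-- [folklore] Coordinates of `H v`: `‖(H v) i‖ ≤ Σ_j ‖H i j‖·‖v j‖`. -/
theorem norm_toEuclideanLin_apply_le {l : Type*} (H : Matrix l n 𝕜) (v : EuclideanSpace 𝕜 n) (i : l) :
    ‖toEuclideanLin H v i‖ ≤ ∑ j, ‖H i j‖ * ‖v j‖ := by
  simp only [Matrix.ofLp_toLpLin, Matrix.toLin'_apply, Matrix.mulVec, dotProduct]
  exact (norm_sum_le _ _).trans (le_of_eq (Finset.sum_congr rfl fun j _ => norm_mul _ _))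

/-- [folklore] **Schur test** (rectangular, Euclidean norms): if every row sum of `‖H i j‖` is `≤ R` and every column sum is `≤ C`
(`0 ≤ R`, `0 ≤ C`), then `‖H v‖ ≤ √(R·C)·‖v‖` — the binder `hH : ‖H v‖ ≤ η‖v‖` of `SaddlePointBound` with `η = √(R·C)`. -/
theorem norm_toEuclideanLin_le_schur {l : Type*} [Fintype l] (H : Matrix l n 𝕜) {R C : ℝ} (hR0 : 0 ≤ R) (hC0 : 0 ≤ C)
    (hR : ∀ i, ∑ j, ‖H i j‖ ≤ R) (hC : ∀ j, ∑ i, ‖H i j‖ ≤ C) (v : EuclideanSpace 𝕜 n) :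
    ‖toEuclideanLin H v‖ ≤ Real.sqrt (R * C) * ‖v‖ := by
  have h2 : ∀ i, ‖toEuclideanLin H v i‖ ^ 2 ≤ R * ∑ j, ‖H i j‖ * ‖v j‖ ^ 2 := by
    intro i
    have hnn : 0 ≤ ∑ j, ‖H i j‖ * ‖v j‖ ^ 2 := Finset.sum_nonneg fun j _ => by positivity
    calc ‖toEuclideanLin H v i‖ ^ 2 ≤ (∑ j, ‖H i j‖ * ‖v j‖) ^ 2 :=
          pow_le_pow_left₀ (norm_nonneg _) (norm_toEuclideanLin_apply_le H v i) 2
      _ ≤ (∑ j, ‖H i j‖) * ∑ j, ‖H i j‖ * ‖v j‖ ^ 2 := sq_sum_mul_le _ fun j _ => norm_nonneg _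
      _ ≤ R * ∑ j, ‖H i j‖ * ‖v j‖ ^ 2 := mul_le_mul_of_nonneg_right (hR i) hnn
  have main : ‖toEuclideanLin H v‖ ^ 2 ≤ R * C * ‖v‖ ^ 2 := by
    rw [EuclideanSpace.norm_sq_eq, EuclideanSpace.norm_sq_eq v, Finset.mul_sum]
    calc ∑ i, ‖toEuclideanLin H v i‖ ^ 2 ≤ ∑ i, R * ∑ j, ‖H i j‖ * ‖v j‖ ^ 2 :=
          Finset.sum_le_sum fun i _ => h2 i
      _ = ∑ j, R * ((∑ i, ‖H i j‖) * ‖v j‖ ^ 2) := by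
          rw [← Finset.mul_sum, ← Finset.mul_sum, Finset.sum_comm]
          congr 1
          exact Finset.sum_congr rfl fun j _ => by rw [Finset.sum_mul]
      _ ≤ ∑ j, R * C * ‖v j‖ ^ 2 := Finset.sum_le_sum fun j _ => by
          rw [mul_assoc]
          exact mul_le_mul_of_nonneg_left (mul_le_mul_of_nonneg_right (hC j) (sq_nonneg _)) hR0
  calc ‖toEuclideanLin H v‖ = Real.sqrt (‖toEuclideanLin H v‖ ^ 2) := (Real.sqrt_sq (norm_nonneg _)).symm
    _ ≤ Real.sqrt (R * C * ‖v‖ ^ 2) := Real.sqrt_le_sqrt main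
    _ = Real.sqrt (R * C) * ‖v‖ := by
        rw [Real.sqrt_mul (mul_nonneg hR0 hC0), Real.sqrt_sq (norm_nonneg _)]

/-- [folklore] **Schur test, symmetric budget**: row sums and column sums of `‖H i j‖` both `≤ ρ` (`0 ≤ ρ`) give `‖H v‖ ≤ ρ‖v‖`
(e.g. `H` Hermitian, or any matrix with `‖H i j‖ = ‖H j i‖`, needs the row bound only). -/
theorem norm_toEuclideanLin_le_of_row_col_le {l : Type*} [Fintype l] (H : Matrix l n 𝕜) {ρ : ℝ} (hρ : 0 ≤ ρ)
    (hR : ∀ i, ∑ j, ‖H i j‖ ≤ ρ) (hC : ∀ j, ∑ i, ‖H i j‖ ≤ ρ) (v : EuclideanSpace 𝕜 n) :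
    ‖toEuclideanLin H v‖ ≤ ρ * ‖v‖ := by
  have h := norm_toEuclideanLin_le_schur H hρ hρ hR hC v
  rwa [Real.sqrt_mul_self hρ] at h

/-! ## §6 Assembly: the split data feed `SaddlePointBound` / `SaddlePointBoundInverse` BY NAME -/

omit [DecidableEq m] in
/-- [folklore] **(a) + (b)**: coercivity of `re ⟪·, H ·⟫` on `ker B` with `γ = lam / (1 + (bG/βZ)²)` from the good-mass lower bound
on `ker B` and the two column bounds. -/
theorem coercive_of_columns (Z : Finset n) {H : Matrix n n 𝕜} {B : Matrix m n 𝕜} {lam βZ bG : ℝ}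
    (hlam : 0 ≤ lam) (hβ : 0 < βZ)
    (hH : ∀ x : EuclideanSpace 𝕜 n, toEuclideanLin B x = 0 →
      lam * ∑ i ∈ Zᶜ, ‖x i‖ ^ 2 ≤ re ⟪x, toEuclideanLin H x⟫_𝕜)
    (hBZ : ∀ y : EuclideanSpace 𝕜 n, (∀ i, i ∉ Z → y i = 0) → βZ * ‖y‖ ≤ ‖toEuclideanLin B y‖)
    (hBG : ∀ y : EuclideanSpace 𝕜 n, (∀ i ∈ Z, y i = 0) → ‖toEuclideanLin B y‖ ≤ bG * ‖y‖) :
    ∀ x : EuclideanSpace 𝕜 n, toEuclideanLin B x = 0 →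
      lam / (1 + (bG / βZ) ^ 2) * ‖x‖ ^ 2 ≤ re ⟪x, toEuclideanLin H x⟫_𝕜 :=
  coercive_of_split Z hlam (sq_nonneg _) hH fun _ hx => bad_mass_le_of_ker Z hβ hBZ hBG hx

/-- [folklore] **Invertibility of the saddle-point matrix from split data** — `SaddlePointBound.isUnit_fromBlocks_conjTranspose` with
`γ = lam/(1 + (bG/βZ)²)` ((a)+(b)), `β` from the bad columns ((c)), `‖H‖ ≤ η`. -/
theorem isUnit_fromBlocks_of_split (Z : Finset n) {H : Matrix n n 𝕜} {B : Matrix m n 𝕜} {lam βZ bG β η : ℝ}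
    (hlam : 0 < lam) (hβZ : 0 < βZ) (hβ : 0 < β) (hη : 0 ≤ η)
    (hH : ∀ x : EuclideanSpace 𝕜 n, toEuclideanLin B x = 0 →
      lam * ∑ i ∈ Zᶜ, ‖x i‖ ^ 2 ≤ re ⟪x, toEuclideanLin H x⟫_𝕜)
    (hBZ : ∀ y : EuclideanSpace 𝕜 n, (∀ i, i ∉ Z → y i = 0) → βZ * ‖y‖ ≤ ‖toEuclideanLin B y‖)
    (hBG : ∀ y : EuclideanSpace 𝕜 n, (∀ i ∈ Z, y i = 0) → ‖toEuclideanLin B y‖ ≤ bG * ‖y‖)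
    (hZ : ∀ q : EuclideanSpace 𝕜 m, β ^ 2 * ‖q‖ ^ 2 ≤ ∑ i ∈ Z, ‖toEuclideanLin Bᴴ q i‖ ^ 2)
    (hHη : ∀ v : EuclideanSpace 𝕜 n, ‖toEuclideanLin H v‖ ≤ η * ‖v‖) :
    IsUnit (Matrix.fromBlocks H Bᴴ B 0) :=
  isUnit_fromBlocks_conjTranspose (div_pos hlam (by positivity)) hβ hη (lbb_of_bad_columns Z hβ.le hZ)
    (coercive_of_columns Z hlam.le hβZ hH hBZ hBG) hHη

/-- [folklore] **Entrywise bounds of the inverse from split data** — `SaddlePointBoundInverse.inv_entry_bound_conjTranspose` with the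
constants of `isUnit_fromBlocks_of_split` (`γ = lam/(1 + (bG/βZ)²)`, `β`, `η`). -/
theorem inv_entry_bound_of_split (Z : Finset n) {H : Matrix n n 𝕜} {B : Matrix m n 𝕜} {lam βZ bG β η : ℝ}
    (hlam : 0 < lam) (hβZ : 0 < βZ) (hβ : 0 < β) (hη : 0 ≤ η)
    (hH : ∀ x : EuclideanSpace 𝕜 n, toEuclideanLin B x = 0 →
      lam * ∑ i ∈ Zᶜ, ‖x i‖ ^ 2 ≤ re ⟪x, toEuclideanLin H x⟫_𝕜)
    (hBZ : ∀ y : EuclideanSpace 𝕜 n, (∀ i, i ∉ Z → y i = 0) → βZ * ‖y‖ ≤ ‖toEuclideanLin B y‖)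
    (hBG : ∀ y : EuclideanSpace 𝕜 n, (∀ i ∈ Z, y i = 0) → ‖toEuclideanLin B y‖ ≤ bG * ‖y‖)
    (hZ : ∀ q : EuclideanSpace 𝕜 m, β ^ 2 * ‖q‖ ^ 2 ≤ ∑ i ∈ Z, ‖toEuclideanLin Bᴴ q i‖ ^ 2)
    (hHη : ∀ v : EuclideanSpace 𝕜 n, ‖toEuclideanLin H v‖ ≤ η * ‖v‖) :
    (∀ i j : n, ‖(Matrix.fromBlocks H Bᴴ B 0)⁻¹ (Sum.inl i) (Sum.inl j)‖ ≤ (lam / (1 + (bG / βZ) ^ 2))⁻¹) ∧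
    (∀ (i : n) (l : m), ‖(Matrix.fromBlocks H Bᴴ B 0)⁻¹ (Sum.inl i) (Sum.inr l)‖ ≤
      β⁻¹ * (1 + η / (lam / (1 + (bG / βZ) ^ 2)))) ∧
    (∀ (k : m) (j : n), ‖(Matrix.fromBlocks H Bᴴ B 0)⁻¹ (Sum.inr k) (Sum.inl j)‖ ≤
      β⁻¹ * (1 + η / (lam / (1 + (bG / βZ) ^ 2)))) ∧
    (∀ k l : m, ‖(Matrix.fromBlocks H Bᴴ B 0)⁻¹ (Sum.inr k) (Sum.inr l)‖ ≤
      β⁻¹ * β⁻¹ * η * (1 + η / (lam / (1 + (bG / βZ) ^ 2)))) :=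
  inv_entry_bound_conjTranspose (div_pos hlam (by positivity)) hβ hη (lbb_of_bad_columns Z hβ.le hZ)
    (coercive_of_columns Z hlam.le hβZ hH hBZ hBG) hHη

end Summit.QuantumFields.BalabanUV.Beta.GAN24.KernelCoercivitySplit
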